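import Summits.QuantumFields.YangMills.Theorems.BalabanUVNodesN15CovariantTwoGridSpeciesFitA
import Summits.QuantumFields.YangMills.Theorems.BalabanUVNodesN15PerCubeGreenTwoGridGradientKnitDefectSummand
import HarnessLib

/-!
# N15 = NE2, road (c) — PROGRA(cvM d L mv kk hL)E (PC), (PC-E-J): THE PAIRING FIT OF THE CUBE-GAUGE TRANSPORTER LETTERS OF A DIRECTION ON THE CUBE's BLOCKS — n15-c∕343's pointwise fit
# `abs_tCoefA_fit_entry_le` (the forward coefficient) WITHOUT cut-offs, for n15-c∕414's displayed row `o_a` (dag-n15-c g35, n15-c∕415)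

Cell `pub-ymgap`, seat `pub-ymgap-dag-n15-c` (generation g35; R134 (a) seat, strategy s1 «first missing estimate»; HUMAN RULING D-0062; chair R424 venue).
`bears_on: R4∕N15 · K3⁸ SpineGivenEndpointR13SepCoPHV (stmt-QuantumFields-27366)`; filed `--kind proof --supports stmt-QuantumFields-27366 --as helper` — COUNT-NEUTRAL.
TWO lemmas, 0 `def`, 0 `sorry`; bookkeeping over n15-c∕343.  Imports BY NAME n15-c∕343 `…CovariantTwoGridSpeciesFitA` (`abs_tCoefA_fit_entry_le`: the entrywise fit of `η′⁻¹(Ad V′ − 1)` at `x′`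
against `η⁻¹(Ad V − 1)` at `πx′` from the (3.35) letters along King's fine line and the oscillation letter `Ω`) and n15-c∕414 `…GradientKnitDefectSummand` (`uN_coordMat_Ad_mul_Ad_mul_Ad_transpose`,
Frobenius-scoped).  (1) `uN_coordMat_Ad_mul_Ad_mul_Ad_transpose_l2`: the same identity read with the operator-norm-scoped coordinates (definitionally the Frobenius one); (2) ★★
`sc_hfitD_of_pairing`: for every cube `k` and fine site `x′` whose coarse block lies in the cube, `Σ_j|(η′⁻¹(Ad(u′_k(x′))Ad(U′_{μ₀}(x′))Ad(u′_k(x′+e′))ᵀ − 1) −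
η⁻¹(Ad(u′_k(σπx′))Ad(U_{μ₀}(πx′))Ad(u′_k(σ(πx′+e)))ᵀ − 1))_{ij}| ≤ |ι|·(η′⁻¹κ√|m|Ω + ((1 + |ι|η′κ√|m|p)^{L^r} − 1)·η′κ√|m|p)` from the letters on King's fine line over `πx′`
(membership `hQl′`) and the oscillation `Ω` along it (`hΩ′`) — the shape of n15-c∕343 `sc_hfitA_of_pairing` without the cut-offs, on the cube's blocks instead of the cut box.

HONEST FRAMING ∕ LIMITS.  Bookkeeping; nothing of [B5]∕[B7]∕[B9] asserted.  NE2⁺ NOT PRINTED, NOT proved; N15 of record untouched (DISCHARGED AS CONSUMED, p687738); K3⁸ OPEN; counts of record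
UNMOVED (typed 28∕28 · discharged 8∕27); one finite 𝕋⁴ at fixed ε per index — NOT infinite volume, NOT OS on ℝ⁴, NOT a mass gap, NOT Clay.  Restate-immune (no Theses import).
-/

noncomputable section

open scoped BigOperators Matrix
open Finset

namespace Summit.QuantumFields.YangMills.BalabanUVNodes.N15.Gluing

open Literature.MathematicalPhysics.QuantumFieldTheory.Balaban1983to89
open Literature.MathematicalPhysics.QuantumFieldTheory.Balaban1983to89.B5Prop11Plancherel (Tor fine unitVec)
open Literature.Barriers.QuantumFields (traceForm)
open Summit.QuantumFields.YangMills.BalabanUVNodes.N15.VectorPiece (kingPr)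
open Summit.QuantumFields.YangMills.BalabanUVNodes.N15.MatrixSpecies (coordMat basisConst basisConst_nonneg)
open Summit.QuantumFields.YangMills.BalabanUVNodes.N15.CovAvg (mprod kingSec)

variable {d : ℕ} {L : ℕ} [NeZero L] {mv kk r : ℕ} {hL : Odd L ∧ 1 < L} {mm : Type} [Fintype mm] [DecidableEq mm] {ι : Type} [Fintype ι] [DecidableEq ι]

section L2

open scoped Matrix.Norms.L2Operator

omit [NeZero L] in
/-- [folklore] `Ad(a)·Ad(b)·Ad(c)ᵀ = Ad(abcᴴ)` for unitary `c`, read with the operator-norm-scoped coordinates (definitionally n15-c∕414's Frobenius-scoped identity).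
[cite: Balaban1985BackgroundPropagators, (3.28) p.395, (3.31) p.395 (shape)] -/
theorem uN_coordMat_Ad_mul_Ad_mul_Ad_transpose_l2 (e : Matrix mm mm ℂ ≃L[ℝ] (ι → ℝ)) (he : ∀ A B : Matrix mm mm ℂ, traceForm A B = e A ⬝ᵥ e B) (a b c : Matrix mm mm ℂ) (hc : cᴴ * c = 1) :
    coordMat e (ContinuousLinearMap.mulLeftRight ℝ (Matrix mm mm ℂ) a aᴴ) * coordMat e (ContinuousLinearMap.mulLeftRight ℝ (Matrix mm mm ℂ) b bᴴ) *
        (coordMat e (ContinuousLinearMap.mulLeftRight ℝ (Matrix mm mm ℂ) c cᴴ))ᵀ = coordMat e (ContinuousLinearMap.mulLeftRight ℝ (Matrix mm mm ℂ) (a * b * cᴴ) (a * b * cᴴ)ᴴ) :=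
  uN_coordMat_Ad_mul_Ad_mul_Ad_transpose e he a b c hc

/-- ★★ **THE PAIRING FIT OF THE CUBE-GAUGE TRANSPORTER LETTERS OF THE DIRECTION `μ₀` ON THE CUBE's BLOCKS** (n15-c∕414's displayed row `o_a`): for every fine site `x′` whose coarse block lies
in cube `k`, `Σ_j|(η′⁻¹(Ad(u′_k(x′))Ad(U′_{μ₀}(x′))Ad(u′_k(x′+e′_{μ₀}))ᵀ − 1) − η⁻¹(Ad(u′_k(σπx′))Ad(U_{μ₀}(πx′))Ad(u′_k(σ(πx′+e_{μ₀})))ᵀ − 1))_{ij}| ≤ |ι|·(η′⁻¹κ√|m|·Ω + ((1+|ι|η′κ√|m|p)^{L^r} − 1)·η′κ√|m|p)`,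
from the (3.35) letters along King's fine line over `πx′` (membership `hQl′`) and the oscillation `Ω` of the transformed fine field along it (`hΩ′`); `U = ` King's straight holonomies of `U′`.
[cite: Balaban1985Averaging, (124)–(125) p.36 (pairing: shape); Balaban1985BackgroundPropagators, (3.34)–(3.35) p.396, (3.50) p.400; King1986, p.664 (pairing)] -/
theorem sc_hfitD_of_pairing (e : Matrix mm mm ℂ ≃L[ℝ] (ι → ℝ)) (he : ∀ A B : Matrix mm mm ℂ, traceForm A B = e A ⬝ᵥ e B)
    (u' : (Fin (d + 1) → ZMod (2 * L)) → ScX' d L mv kk r hL → Matrix mm mm ℂ) (hu' : ∀ k z, (u' k z)ᴴ * u' k z = 1)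
    (U' : Fin (d + 1) → ScX' d L mv kk r hL → Matrix mm mm ℂ) (hU' : ∀ μ z, (U' μ z)ᴴ * U' μ z = 1) (U : Fin (d + 1) → ScX d L mv kk hL → Matrix mm mm ℂ)
    (hpair : ∀ μ y, U μ y = mprod (fun t => U' μ (kingSec (cvM d L mv kk hL) L kk r y + t • unitVec (fine (L ^ r * L ^ kk) (cvM d L mv kk hL)) μ)) (L ^ r)) (μ₀ : Fin (d + 1))
    (Qf : (Fin (d + 1) → ZMod (2 * L)) → Set (ScX' d L mv kk r hL)) {p Ω : ℝ} (hp : 0 ≤ p)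
    (hF1 : ∀ k μ z, z ∈ Qf k → ‖u' k z * U' μ z * (u' k (scShift' d L mv kk r hL μ z))ᴴ - 1‖ ≤ ((((L ^ r * L ^ kk : ℕ) : ℝ))⁻¹) * p)
    (hQl' : ∀ k x', scBlk d L mv kk hL (kingPr L kk r (cvM d L mv kk hL) x') ∈ cvSk d L mv kk hL k → ∀ t, t < L ^ r →
      kingSec (cvM d L mv kk hL) L kk r (kingPr L kk r (cvM d L mv kk hL) x') + t • unitVec (fine (L ^ r * L ^ kk) (cvM d L mv kk hL)) μ₀ ∈ Qf k)
    (hΩ' : ∀ k x', scBlk d L mv kk hL (kingPr L kk r (cvM d L mv kk hL) x') ∈ cvSk d L mv kk hL k → ∀ t < L ^ r, ‖u' k x' * U' μ₀ x' * (u' k (scShift' d L mv kk r hL μ₀ x'))ᴴ -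
      (u' k (kingSec (cvM d L mv kk hL) L kk r (kingPr L kk r (cvM d L mv kk hL) x') + t • unitVec (fine (L ^ r * L ^ kk) (cvM d L mv kk hL)) μ₀) *
        U' μ₀ (kingSec (cvM d L mv kk hL) L kk r (kingPr L kk r (cvM d L mv kk hL) x') + t • unitVec (fine (L ^ r * L ^ kk) (cvM d L mv kk hL)) μ₀) *
        (u' k (kingSec (cvM d L mv kk hL) L kk r (kingPr L kk r (cvM d L mv kk hL) x') + t • unitVec (fine (L ^ r * L ^ kk) (cvM d L mv kk hL)) μ₀ + unitVec (fine (L ^ r * L ^ kk) (cvM d L mv kk hL)) μ₀))ᴴ)‖ ≤ Ω) :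
    ∀ k x', scBlk d L mv kk hL (kingPr L kk r (cvM d L mv kk hL) x') ∈ cvSk d L mv kk hL k → ∀ i, ∑ j, |(((L ^ r * L ^ kk : ℕ) : ℝ) • (coordMat e (ContinuousLinearMap.mulLeftRight ℝ (Matrix mm mm ℂ) (u' k x') (u' k x')ᴴ) * coordMat e (ContinuousLinearMap.mulLeftRight ℝ (Matrix mm mm ℂ) (U' μ₀ x') (U' μ₀ x')ᴴ) * (coordMat e (ContinuousLinearMap.mulLeftRight ℝ (Matrix mm mm ℂ) (u' k (scShift' d L mv kk r hL μ₀ x')) (u' k (scShift' d L mv kk r hL μ₀ x'))ᴴ))ᵀ - 1) - ((L ^ kk : ℕ) : ℝ) • (coordMat e (ContinuousLinearMap.mulLeftRight ℝ (Matrix mm mm ℂ) (u' k (kingSec (cvM d L mv kk hL) L kk r (kingPr L kk r (cvM d L mv kk hL) x'))) (u' k (kingSec (cvM d L mv kk hL) L kk r (kingPr L kk r (cvM d L mv kk hL) x')))ᴴ) * coordMat e (ContinuousLinearMap.mulLeftRight ℝ (Matrix mm mm ℂ) (U μ₀ (kingPr L kk r (cvM d L mv kk hL) x')) (U μ₀ (kingPr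 L kk r (cvM d L mv kk hL) x'))ᴴ) * (coordMat e (ContinuousLinearMap.mulLeftRight ℝ (Matrix mm mm ℂ) (u' k (kingSec (cvM d L mv kk hL) L kk r (scShift d L mv kk hL μ₀ (kingPr L kk r (cvM d L mv kk hL) x')))) (u' k (kingSec (cvM d L mv kk hL) L kk r (scShift d L mv kk hL μ₀ (kingPr L kk r (cvM d L mv kk hL) x'))))ᴴ))ᵀ - 1)) i j| ≤ Fintype.card ι * (((L ^ r * L ^ kk : ℕ) : ℝ) * ((@basisConst ι _ (Matrix mm mm ℂ) Matrix.frobeniusNormedAddCommGroup Matrix.frobeniusNormedSpace e * (2 * Real.sqrt (Fintype.card mm))) * (Real.sqrt (Fintype.card mm) * Ω) + ((1 + Fintype.card ι * (((((L ^ r * L ^ kk : ℕ) : ℝ))⁻¹) * (@basisConst ι _ (Matrix mm mm ℂ) Matrix.frobeniusNormedAddCommGroup Matrix.frobeniusNormedSpace e * (2 * Real.sqrt (Fintype.card mm)) * (Real.sqrt (Fintype.card mm) * p)))) ^ (L ^ r) - 1) * (((((L ^ r * L ^ kk : ℕ) : ℝ))⁻¹) * (@basisConst ι _ (Matrix mm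 mm ℂ) Matrix.frobeniusNormedAddCommGroup Matrix.frobeniusNormedSpace e * (2 * Real.sqrt (Fintype.card mm)) * (Real.sqrt (Fintype.card mm) * p))))) := by
  intro k x' hx i
  rw [uN_coordMat_Ad_mul_Ad_mul_Ad_transpose_l2 e he (u' k x') (U' μ₀ x') (u' k (scShift' d L mv kk r hL μ₀ x')) (hu' k _),
    uN_coordMat_Ad_mul_Ad_mul_Ad_transpose_l2 e he (u' k (kingSec (cvM d L mv kk hL) L kk r (kingPr L kk r (cvM d L mv kk hL) x'))) (U μ₀ (kingPr L kk r (cvM d L mv kk hL) x')) (u' k (kingSec (cvM d L mv kk hL) L kk r (scShift d L mv kk hL μ₀ (kingPr L kk r (cvM d L mv kk hL) x')))) (hu' k _)]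
  have hentry : ∀ j, |((((L ^ r * L ^ kk : ℕ) : ℝ) • (coordMat e (ContinuousLinearMap.mulLeftRight ℝ (Matrix mm mm ℂ) ((u' k x' * U' μ₀ x' * (u' k (scShift' d L mv kk r hL μ₀ x'))ᴴ)) ((u' k x' * U' μ₀ x' * (u' k (scShift' d L mv kk r hL μ₀ x'))ᴴ))ᴴ) - 1)) - (((L ^ kk : ℕ) : ℝ) • (coordMat e (ContinuousLinearMap.mulLeftRight ℝ (Matrix mm mm ℂ) ((u' k (kingSec (cvM d L mv kk hL) L kk r (kingPr L kk r (cvM d L mv kk hL) x')) * U μ₀ (kingPr L kk r (cvM d L mv kk hL) x') * (u' k (kingSec (cvM d L mv kk hL) L kk r (scShift d L mv kk hL μ₀ (kingPr L kk r (cvM d L mv kk hL) x'))))ᴴ)) ((u' k (kingSec (cvM d L mv kk hL) L kk r (kingPr L kk r (cvM d L mv kk hL) x')) * U μ₀ (kingPr L kk r (cvM d L mv kk hL) x') * (u' k (kingSec (cvM d L mv kk hL) L kk r (scShift d L mv kk hL μ₀ (kingPr L kk r (cvM d L mv kk hL) x'))))ᴴ))ᴴ) - 1))) i j| ≤ ((L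 ^ r * L ^ kk : ℕ) : ℝ) * ((@basisConst ι _ (Matrix mm mm ℂ) Matrix.frobeniusNormedAddCommGroup Matrix.frobeniusNormedSpace e * (2 * Real.sqrt (Fintype.card mm))) * (Real.sqrt (Fintype.card mm) * Ω) + ((1 + Fintype.card ι * (((((L ^ r * L ^ kk : ℕ) : ℝ))⁻¹) * (@basisConst ι _ (Matrix mm mm ℂ) Matrix.frobeniusNormedAddCommGroup Matrix.frobeniusNormedSpace e * (2 * Real.sqrt (Fintype.card mm)) * (Real.sqrt (Fintype.card mm) * p)))) ^ (L ^ r) - 1) * (((((L ^ r * L ^ kk : ℕ) : ℝ))⁻¹) * (@basisConst ι _ (Matrix mm mm ℂ) Matrix.frobeniusNormedAddCommGroup Matrix.frobeniusNormedSpace e * (2 * Real.sqrt (Fintype.card mm)) * (Real.sqrt (Fintype.card mm) * p)))) := fun j => by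
    have h := abs_tCoefA_fit_entry_le e (hu' k) hU' μ₀ (hpair μ₀) hp (kingPr L kk r (cvM d L mv kk hL) x') x' (fun t ht => hF1 k μ₀ _ (hQl' k x' hx t ht)) (fun t ht => hΩ' k x' hx t ht) i j
    rw [inv_inv, inv_inv] at h
    exact h
  calc ∑ j, |((((L ^ r * L ^ kk : ℕ) : ℝ) • (coordMat e (ContinuousLinearMap.mulLeftRight ℝ (Matrix mm mm ℂ) ((u' k x' * U' μ₀ x' * (u' k (scShift' d L mv kk r hL μ₀ x'))ᴴ)) ((u' k x' * U' μ₀ x' * (u' k (scShift' d L mv kk r hL μ₀ x'))ᴴ))ᴴ) - 1)) - (((L ^ kk : ℕ) : ℝ) • (coordMat e (ContinuousLinearMap.mulLeftRight ℝ (Matrix mm mm ℂ) ((u' k (kingSec (cvM d L mv kk hL) L kk r (kingPr L kk r (cvM d L mv kk hL) x')) * U μ₀ (kingPr L kk r (cvM d L mv kk hL) x') * (u' k (kingSec (cvM d L mv kk hL) L kk r (scShift d L mv kk hL μ₀ (kingPr L kk r (cvM d L mv kk hL) x'))))ᴴ)) ((u' k (kingSec (cvM d L mv kk hL) L kk r (kingPr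 L kk r (cvM d L mv kk hL) x')) * U μ₀ (kingPr L kk r (cvM d L mv kk hL) x') * (u' k (kingSec (cvM d L mv kk hL) L kk r (scShift d L mv kk hL μ₀ (kingPr L kk r (cvM d L mv kk hL) x'))))ᴴ))ᴴ) - 1))) i j| ≤ ∑ _j : ι, (((L ^ r * L ^ kk : ℕ) : ℝ) * ((@basisConst ι _ (Matrix mm mm ℂ) Matrix.frobeniusNormedAddCommGroup Matrix.frobeniusNormedSpace e * (2 * Real.sqrt (Fintype.card mm))) * (Real.sqrt (Fintype.card mm) * Ω) + ((1 + Fintype.card ι * (((((L ^ r * L ^ kk : ℕ) : ℝ))⁻¹) * (@basisConst ι _ (Matrix mm mm ℂ) Matrix.frobeniusNormedAddCommGroup Matrix.frobeniusNormedSpace e * (2 * Real.sqrt (Fintype.card mm)) * (Real.sqrt (Fintype.card mm) * p)))) ^ (L ^ r) - 1) * (((((L ^ r * L ^ kk : ℕ) : ℝ))⁻¹) * (@basisConst ι _ (Matrix mm mm ℂ) Matrix.frobeniusNormedAddCommGroup Matrix.frobeniusNormedSpace e * (2 * Real.sqrt (Fintype.card mm)) * (Real.sqrt (Fintype.card mm)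 * p))))) := Finset.sum_le_sum fun j _ => hentry j
    _ = Fintype.card ι * (((L ^ r * L ^ kk : ℕ) : ℝ) * ((@basisConst ι _ (Matrix mm mm ℂ) Matrix.frobeniusNormedAddCommGroup Matrix.frobeniusNormedSpace e * (2 * Real.sqrt (Fintype.card mm))) * (Real.sqrt (Fintype.card mm) * Ω) + ((1 + Fintype.card ι * (((((L ^ r * L ^ kk : ℕ) : ℝ))⁻¹) * (@basisConst ι _ (Matrix mm mm ℂ) Matrix.frobeniusNormedAddCommGroup Matrix.frobeniusNormedSpace e * (2 * Real.sqrt (Fintype.card mm)) * (Real.sqrt (Fintype.card mm) * p)))) ^ (L ^ r) - 1) * (((((L ^ r * L ^ kk : ℕ) : ℝ))⁻¹) * (@basisConst ι _ (Matrix mm mm ℂ) Matrix.frobeniusNormedAddCommGroup Matrix.frobeniusNormedSpace e * (2 * Real.sqrt (Fintype.card mm)) * (Real.sqrt (Fintype.card mm) * p))))) := by rw [Finset.sum_const, Finset.card_univ, nsmul_eq_mul]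

end L2

end Summit.QuantumFields.YangMills.BalabanUVNodes.N15.Gluing

end
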